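import Summits.HubbardSuperconductivity.HubbardSuperconductivity.Theorems.KacWindowPenaltyWindowGapPenalisedForms

/-!
# Route `KacWindowPenalty` — crux `WindowGap` (stmt-HubbardSuperconductivity-1088), line
# `sector-invisible-dressing`: stub `stub_dressingInvisible`

On the joint sector `K = szSector N 0` of the Hubbard torus `(ℤ/Lℤ)²` the DRESSING
`S = −μ(N̂ − N) + k(N̂ − N)² − h(Δ_d + Δ_dᴴ)` (chemical shift, Kac charging term, `d`-wave pair
source; `N̂ = totalNumber`, `Δ_d = pairField dWaveFormFactor L`) has ZERO quadratic form:
`Re ⟨ψ, S ψ⟩ = 0` for every `ψ ∈ K`. This is hypothesis `hS` of the line's abstract bridge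
`dressedBridge` (adding a sector-invisible dressing and relaxing the sector to the whole Fock space
can only lower the minimal energy).

Proof: `N̂ ψ = N ψ` on `N`-particle vectors (`totalNumber_mulVec_of_isNParticle`), so
`(N̂ − N)ψ = 0` kills the shift and the charging term; the source has no diagonal matrix element in
an `N̂`-eigenvector by the SELECTION RULE `⟨ψ, X ψ⟩ = 0` for an operator of nonzero charge
(`[N̂, X] = cX`, `c ≠ 0`; here `[N̂, Δ_d] = −2Δ_d`, `totalNumber_commutator_pairFieldAt`, and
`[N̂, Δ_dᴴ] = +2Δ_dᴴ` by taking adjoints). Pure finite-dimensional linear algebra: H. Tasaki,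
*Physics and Mathematics of Quantum Many-Body Systems* (2020) §9.3 (particle-number bookkeeping),
§2.1. Support for the crux (`--supports stmt-HubbardSuperconductivity-1088`). No definitions.
-/

-- the mandated namespace `Summit.<Summit>.<Problem>.Theorems` repeats `HubbardSuperconductivity`
-- (single-problem summit, D-0017), which the `dupNamespace` linter flags on every declaration
set_option linter.dupNamespace false

namespace Summit.HubbardSuperconductivity.HubbardSuperconductivity.Theorems

open Matrix Literature.MathematicalPhysics.QuantumLattice

section SelectionRule

variable {m : Type*} [Fintype m]

/-- Moving a Hermitian matrix across the inner product onto an eigenvector with eigenvalue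
`n : ℕ`: `⟨v, M w⟩ = ⟨M v, w⟩ = n ⟨v, w⟩`. [folklore] -/
theorem star_dotProduct_mulVec_of_isHermitian_of_eigen {M : Matrix m m ℂ} (hM : M.IsHermitian)
    {v : m → ℂ} {n : ℕ} (hv : M *ᵥ v = (n : ℂ) • v) (w : m → ℂ) :
    star v ⬝ᵥ (M *ᵥ w) = (n : ℂ) * (star v ⬝ᵥ w) := by
  have h : star (M *ᵥ v) ⬝ᵥ w = star v ⬝ᵥ (M *ᵥ w) := by
    rw [star_mulVec, hM.eq, dotProduct_mulVec]
  rw [← h, hv, star_smul, smul_dotProduct, smul_eq_mul, Complex.star_def, map_natCast]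

/-- **Selection rule for a charged operator.** If `M` is Hermitian, `[M, X] = c X` with `c ≠ 0`,
and `M v = n v` (`n : ℕ`), then `⟨v, X v⟩ = 0`: indeed `⟨v, [M, X] v⟩ = n⟨v, Xv⟩ − n⟨v, Xv⟩ = 0`
while it also equals `c ⟨v, X v⟩`. Tasaki (2020) §9.3. [folklore] -/
theorem star_dotProduct_mulVec_eq_zero_of_charge {M X : Matrix m m ℂ} (hM : M.IsHermitian)
    {c : ℂ} (hc : c ≠ 0) (hX : M * X - X * M = c • X) {v : m → ℂ} {n : ℕ}
    (hv : M *ᵥ v = (n : ℂ) • v) : star v ⬝ᵥ (X *ᵥ v) = 0 := by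
  have h := congrArg (fun Y : Matrix m m ℂ => star v ⬝ᵥ (Y *ᵥ v)) hX
  rw [smul_mulVec, dotProduct_smul, smul_eq_mul, sub_mulVec, dotProduct_sub, ← mulVec_mulVec,
    ← mulVec_mulVec, star_dotProduct_mulVec_of_isHermitian_of_eigen hM hv, hv, mulVec_smul,
    dotProduct_smul, smul_eq_mul, sub_self] at h
  exact (mul_eq_zero.1 h.symm).resolve_left hc

/-- The adjoint of a charged operator has no diagonal matrix element either:
`⟨v, Xᴴ v⟩ = conj ⟨v, X v⟩ = 0` under the hypotheses of
`star_dotProduct_mulVec_eq_zero_of_charge`. [folklore] -/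
theorem star_dotProduct_conjTranspose_mulVec_eq_zero_of_charge {M X : Matrix m m ℂ}
    (hM : M.IsHermitian) {c : ℂ} (hc : c ≠ 0) (hX : M * X - X * M = c • X) {v : m → ℂ} {n : ℕ}
    (hv : M *ᵥ v = (n : ℂ) • v) : star v ⬝ᵥ (Xᴴ *ᵥ v) = 0 := by
  rw [star_dotProduct, star_mulVec, conjTranspose_conjTranspose, ← dotProduct_mulVec,
    star_dotProduct_mulVec_eq_zero_of_charge hM hc hX hv, star_zero]

end SelectionRule

/-- **Stub `stub_dressingInvisible`.** On the joint sector `szSector N 0` of the Hubbard torus the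
dressing `−μ(N̂ − N) + k(N̂ − N)² − h(Δ_d + Δ_dᴴ)` has zero quadratic form: `N̂ψ = Nψ`
(`totalNumber_mulVec_of_isNParticle`) kills the first two terms, and `⟨ψ, Δ_d ψ⟩ = ⟨ψ, Δ_dᴴ ψ⟩ = 0`
by the selection rule for the charge-`(−2)` operator `Δ_d` (`[N̂, Δ_d] = −2Δ_d`) in the
`N̂`-eigenvector `ψ`. Tasaki (2020) §9.3. [folklore] -/
theorem stub_dressingInvisible (L : ℕ) [NeZero L] (N : ℕ) (μ k h : ℝ)
    (ψ : Fock (Orb (FermionTorus 2 L))) (hψ : ψ ∈ szSector N 0) :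
    (star ψ ⬝ᵥ (-((μ : ℂ) • ((totalNumber : Matrix (Finset (Orb (FermionTorus 2 L)))
          (Finset (Orb (FermionTorus 2 L))) ℂ) - (N : ℂ) • 1)) +
        (k : ℂ) • (((totalNumber : Matrix (Finset (Orb (FermionTorus 2 L)))
          (Finset (Orb (FermionTorus 2 L))) ℂ) - (N : ℂ) • 1) *
          ((totalNumber : Matrix (Finset (Orb (FermionTorus 2 L)))
          (Finset (Orb (FermionTorus 2 L))) ℂ) - (N : ℂ) • 1)) -
        (h : ℂ) • (pairField dWaveFormFactor L + (pairField dWaveFormFactor L)ᴴ)) *ᵥ ψ).re = 0 := by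
  have hN : IsNParticle N ψ := ((mem_szSector_iff N 0 ψ).1 hψ).1
  have hNψ : (totalNumber : Matrix (Finset (Orb (FermionTorus 2 L)))
      (Finset (Orb (FermionTorus 2 L))) ℂ) *ᵥ ψ = (N : ℂ) • ψ :=
    totalNumber_mulVec_of_isNParticle hN
  -- `(N̂ − N)ψ = 0`
  have hsub : ((totalNumber : Matrix (Finset (Orb (FermionTorus 2 L)))
      (Finset (Orb (FermionTorus 2 L))) ℂ) - (N : ℂ) • 1) *ᵥ ψ = 0 := by
    rw [sub_mulVec, smul_mulVec, one_mulVec, hNψ, sub_self]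
  -- `[N̂, Δ_d] = −2 Δ_d`
  have hcomm : (totalNumber : Matrix (Finset (Orb (FermionTorus 2 L)))
      (Finset (Orb (FermionTorus 2 L))) ℂ) * pairField dWaveFormFactor L -
        pairField dWaveFormFactor L * totalNumber = (-2 : ℂ) • pairField dWaveFormFactor L := by
    rw [← pairFieldAt_zero]
    exact totalNumber_commutator_pairFieldAt dWaveFormFactor L 0
  have h2 : (-2 : ℂ) ≠ 0 := by norm_num
  have hsrc : star ψ ⬝ᵥ ((pairField dWaveFormFactor L + (pairField dWaveFormFactor L)ᴴ) *ᵥ ψ) =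
      0 := by
    rw [add_mulVec, dotProduct_add,
      star_dotProduct_mulVec_eq_zero_of_charge totalNumber_isHermitian h2 hcomm hNψ,
      star_dotProduct_conjTranspose_mulVec_eq_zero_of_charge totalNumber_isHermitian h2 hcomm hNψ,
      add_zero]
  rw [sub_mulVec, add_mulVec, neg_mulVec, smul_mulVec, smul_mulVec, smul_mulVec, ← mulVec_mulVec,
    hsub, mulVec_zero, smul_zero, neg_zero, smul_zero, zero_add, zero_sub, dotProduct_neg,
    dotProduct_smul, hsrc, smul_zero, neg_zero, Complex.zero_re]

end Summit.HubbardSuperconductivity.HubbardSuperconductivity.Theorems
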